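import Summits.Ventures.Crystal3D.Theorems.StickyWulffConstantPolycrystalWulffBoundGapTreeChimera
import Literature.Analysis.Convexity.CavalieriSlices

/-!
# Ball caps in `ℝ³` (helper for line `PolyDensity` of crux `PolycrystalWulffBound`, stmt-Ventures-19482)

Route `StickyWulffConstant` of the venture `Summits/Ventures/Crystal3D`, second prover lane (poly-p2,
gen 14).  Elementary volumes used by the generic shift lemma (`…GenericShift.lean`):
* `volume_prod_disc` — the disc `{y₁² + y₂² ≤ c} ⊆ ℝ × ℝ` has product-Lebesgue measure `π·c` (`c ≥ 0`);
* `norm_sq_frame` — `‖s n + a U + b V‖² = s² + a² + b²` in an orthonormal frame;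
* `volume_closedBall_inter_ioi` — **ball cap**: `|B̄(0,R) ∩ {τ < ⟪y,n⟫}| = π(2R³/3 − R²τ + τ³/3)` for
  `τ ∈ [−R, R]` (Cavalieri by planes ⊥ n, `Literature.Analysis.Convexity.volume_eq_lintegral_volume_chartSlice`);
* `ballCap_five_le_ballCap_three` — the one real inequality `cap_{√5}(σ) ≤ cap_{√3}(σ − 1)` on `[1, √5]`.
WHAT THIS IS NOT: anything about the crux itself.
-/

noncomputable section

open scoped BigOperators InnerProductSpace ENNReal Pointwise
open MeasureTheory Set

namespace Summit.Ventures.Crystal3D.Theorems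

open Summit.Ventures.Crystal3D.Cruxes.TextureLiminf.TexShadow (E3)

/-- Area of the centred closed Euclidean disc `{y₁² + y₂² ≤ c}` in `ℝ × ℝ` (product Lebesgue measure):
`π·c` for `c ≥ 0` (and `0`, as is `ofReal (π c)`, for `c < 0`). -/
theorem volume_prod_disc (c : ℝ) :
    volume {y : ℝ × ℝ | y.1 ^ 2 + y.2 ^ 2 ≤ c} = ENNReal.ofReal (Real.pi * c) := by
  by_cases hc : c < 0
  · have hempty : {y : ℝ × ℝ | y.1 ^ 2 + y.2 ^ 2 ≤ c} = ∅ := by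
      ext y
      simp only [mem_setOf_eq, mem_empty_iff_false, iff_false, not_le]
      nlinarith [sq_nonneg y.1, sq_nonneg y.2]
    rw [hempty, measure_empty, ENNReal.ofReal_of_nonpos (by nlinarith [Real.pi_pos])]
  rw [not_lt] at hc
  -- transfer to `EuclideanSpace ℝ (Fin 2)`
  have hφ : MeasurePreserving (fun x : EuclideanSpace ℝ (Fin 2) =>
      MeasurableEquiv.finTwoArrow (WithLp.ofLp x)) volume volume :=
    (volume_preserving_finTwoArrow ℝ).comp (PiLp.volume_preserving_ofLp (Fin 2))
  have hSm : MeasurableSet {y : ℝ × ℝ | y.1 ^ 2 + y.2 ^ 2 ≤ c} :=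
    measurableSet_le ((measurable_fst.pow_const 2).add (measurable_snd.pow_const 2)) measurable_const
  rw [← hφ.measure_preimage hSm.nullMeasurableSet]
  have hpre : (fun x : EuclideanSpace ℝ (Fin 2) => MeasurableEquiv.finTwoArrow (WithLp.ofLp x)) ⁻¹'
      {y : ℝ × ℝ | y.1 ^ 2 + y.2 ^ 2 ≤ c} =
      Metric.closedBall (0 : EuclideanSpace ℝ (Fin 2)) (Real.sqrt c) := by
    ext x
    simp only [mem_preimage, mem_setOf_eq, MeasurableEquiv.finTwoArrow_apply, Metric.mem_closedBall,
      dist_zero_right]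
    rw [EuclideanSpace.norm_eq, Fin.sum_univ_two, Real.norm_eq_abs, Real.norm_eq_abs, sq_abs, sq_abs]
    constructor
    · intro h
      exact Real.sqrt_le_sqrt h
    · intro h
      have h0 : 0 ≤ (WithLp.ofLp x) 0 ^ 2 + (WithLp.ofLp x) 1 ^ 2 := by positivity
      have h3 : Real.sqrt ((WithLp.ofLp x) 0 ^ 2 + (WithLp.ofLp x) 1 ^ 2) ^ 2 ≤ Real.sqrt c ^ 2 := by
        gcongr
      rw [Real.sq_sqrt h0, Real.sq_sqrt hc] at h3
      exact h3
  rw [hpre, EuclideanSpace.volume_closedBall_fin_two, ← ENNReal.ofReal_pow (Real.sqrt_nonneg _),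
    Real.sq_sqrt hc, ← ENNReal.ofReal_mul hc, mul_comm]

/-- Squared norm in an orthonormal frame `(n, U, V)` of `ℝ³`. -/
theorem norm_sq_frame {n U V : E3} (hn : ‖n‖ = 1) (hU : ‖U‖ = 1) (hV : ‖V‖ = 1)
    (hUV : ⟪U, V⟫_ℝ = 0) (hnU : ⟪n, U⟫_ℝ = 0) (hnV : ⟪n, V⟫_ℝ = 0) (s a b : ℝ) :
    ‖s • n + a • U + b • V‖ ^ 2 = s ^ 2 + a ^ 2 + b ^ 2 := by
  have hnn : ⟪n, n⟫_ℝ = 1 := by rw [real_inner_self_eq_norm_sq, hn, one_pow]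
  have hUU : ⟪U, U⟫_ℝ = 1 := by rw [real_inner_self_eq_norm_sq, hU, one_pow]
  have hVV : ⟪V, V⟫_ℝ = 1 := by rw [real_inner_self_eq_norm_sq, hV, one_pow]
  have hUn : ⟪U, n⟫_ℝ = 0 := by rw [real_inner_comm]; exact hnU
  have hVn : ⟪V, n⟫_ℝ = 0 := by rw [real_inner_comm]; exact hnV
  have hVU : ⟪V, U⟫_ℝ = 0 := by rw [real_inner_comm]; exact hUV
  rw [← real_inner_self_eq_norm_sq]
  simp only [inner_add_left, inner_add_right, real_inner_smul_left, real_inner_smul_right,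
    hnn, hUU, hVV, hUn, hVn, hVU, hUV, hnU, hnV]
  ring

/-- **Volume of a ball cap.**  For a unit vector `n`, `R > 0` and `τ ∈ [−R, R]`:
`|closedBall(0,R) ∩ {τ < ⟪y, n⟫}| = π·(2R³/3 − R²τ + τ³/3)`. -/
theorem volume_closedBall_inter_ioi {n : E3} (hn : ‖n‖ = 1) {R τ : ℝ} (hR : 0 < R)
    (hτR : τ ≤ R) (hRτ : -R ≤ τ) :
    volume (Metric.closedBall (0 : E3) R ∩ {y : E3 | τ < ⟪y, n⟫_ℝ}) =
      ENNReal.ofReal (Real.pi * (2 * R ^ 3 / 3 - R ^ 2 * τ + τ ^ 3 / 3)) := by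
  obtain ⟨U, V, hU, hV, hUV, hnU, hnV⟩ := Literature.Analysis.Convexity.exists_orthonormal_pair_perp n
  have hSm : MeasurableSet (Metric.closedBall (0 : E3) R ∩ {y : E3 | τ < ⟪y, n⟫_ℝ}) :=
    Metric.isClosed_closedBall.measurableSet.inter
      (measurableSet_lt measurable_const (measurable_id.inner measurable_const))
  rw [Literature.Analysis.Convexity.volume_eq_lintegral_volume_chartSlice hn hU hV hUV hnU hnV 0 hSm]
  -- the slices
  have hnn : ⟪n, n⟫_ℝ = 1 := by rw [real_inner_self_eq_norm_sq, hn, one_pow]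
  have hUn : ⟪U, n⟫_ℝ = 0 := by rw [real_inner_comm]; exact hnU
  have hVn : ⟪V, n⟫_ℝ = 0 := by rw [real_inner_comm]; exact hnV
  set g : ℝ → ℝ≥0∞ := fun s => ENNReal.ofReal (Real.pi * (R ^ 2 - s ^ 2)) with hg
  have hslice : ∀ s : ℝ, volume {y : ℝ × ℝ | (0 : E3) + s • n + y.1 • U + y.2 • V ∈
      Metric.closedBall (0 : E3) R ∩ {y : E3 | τ < ⟪y, n⟫_ℝ}} = (Ioc τ R).indicator g s := by
    intro s
    by_cases hs : τ < s
    · have hset : {y : ℝ × ℝ | (0 : E3) + s • n + y.1 • U + y.2 • V ∈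
          Metric.closedBall (0 : E3) R ∩ {y : E3 | τ < ⟪y, n⟫_ℝ}} =
          {y : ℝ × ℝ | y.1 ^ 2 + y.2 ^ 2 ≤ R ^ 2 - s ^ 2} := by
        ext y
        have hnorm := norm_sq_frame hn hU hV hUV hnU hnV s y.1 y.2
        have hin' : ⟪s • n + y.1 • U + y.2 • V, n⟫_ℝ = s := by
          rw [inner_add_left, inner_add_left, real_inner_smul_left, real_inner_smul_left,
            real_inner_smul_left, hnn, hUn, hVn]; ring
        simp only [zero_add, mem_setOf_eq, mem_inter_iff, Metric.mem_closedBall, dist_zero_right, hin',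
          hs, and_true]
        constructor
        · intro h1
          have h2 : ‖s • n + y.1 • U + y.2 • V‖ ^ 2 ≤ R ^ 2 := by gcongr
          rw [hnorm] at h2; linarith
        · intro h1
          have h2 : ‖s • n + y.1 • U + y.2 • V‖ ^ 2 ≤ R ^ 2 := by rw [hnorm]; linarith
          by_contra h3
          rw [not_le] at h3
          have h4 := pow_lt_pow_left₀ h3 hR.le two_ne_zero
          linarith
      rw [hset, volume_prod_disc]
      by_cases hsR : s ≤ R
      · rw [indicator_of_mem (show s ∈ Ioc τ R from ⟨hs, hsR⟩)]
      · rw [indicator_of_notMem (show s ∉ Ioc τ R from fun h => hsR h.2)]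
        rw [not_le] at hsR
        have : Real.pi * (R ^ 2 - s ^ 2) ≤ 0 := by
          have h4 := pow_lt_pow_left₀ hsR hR.le two_ne_zero
          nlinarith [Real.pi_pos]
        exact ENNReal.ofReal_of_nonpos this
    · have hset : {y : ℝ × ℝ | (0 : E3) + s • n + y.1 • U + y.2 • V ∈
          Metric.closedBall (0 : E3) R ∩ {y : E3 | τ < ⟪y, n⟫_ℝ}} = ∅ := by
        ext y
        have hin' : ⟪s • n + y.1 • U + y.2 • V, n⟫_ℝ = s := by
          rw [inner_add_left, inner_add_left, real_inner_smul_left, real_inner_smul_left,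
            real_inner_smul_left, hnn, hUn, hVn]; ring
        simp only [zero_add, mem_setOf_eq, mem_inter_iff, mem_empty_iff_false, iff_false, not_and, hin']
        exact fun _ h => hs h
      rw [hset, measure_empty, indicator_of_notMem (show s ∉ Ioc τ R from fun h => hs h.1)]
  simp_rw [hslice]
  rw [lintegral_indicator measurableSet_Ioc, hg]
  -- the real integral
  have hcont : Continuous fun s : ℝ => Real.pi * (R ^ 2 - s ^ 2) := by fun_prop
  have hint : IntegrableOn (fun s : ℝ => Real.pi * (R ^ 2 - s ^ 2)) (Ioc τ R) volume :=
    hcont.integrableOn_Ioc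
  have hnn' : 0 ≤ᵐ[volume.restrict (Ioc τ R)] fun s : ℝ => Real.pi * (R ^ 2 - s ^ 2) := by
    rw [Filter.EventuallyLE, ae_restrict_iff' measurableSet_Ioc]
    refine Filter.Eventually.of_forall fun s hs => ?_
    have h1 : s ^ 2 ≤ R ^ 2 := by
      have hs1 : -R ≤ s := by linarith [hs.1]
      have hs2 : s ≤ R := hs.2
      nlinarith
    show (0 : ℝ) ≤ Real.pi * (R ^ 2 - s ^ 2)
    nlinarith [Real.pi_pos]
  rw [← ofReal_integral_eq_lintegral_ofReal hint hnn', ← intervalIntegral.integral_of_le hτR]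
  congr 1
  rw [intervalIntegral.integral_const_mul, intervalIntegral.integral_sub intervalIntegrable_const
    (intervalIntegral.intervalIntegrable_pow 2), intervalIntegral.integral_const, integral_pow]
  simp only [smul_eq_mul]
  ring

/-- The one polynomial inequality: for `σ ∈ [1, √5]` the `√5`-ball cap above `σ` is smaller than the
`√3`-ball cap above `σ − 1`. -/
theorem ballCap_five_le_ballCap_three {σ : ℝ} (h1 : 1 ≤ σ) (h5 : σ ≤ Real.sqrt 5) :
    Real.pi * (2 * Real.sqrt 5 ^ 3 / 3 - Real.sqrt 5 ^ 2 * σ + σ ^ 3 / 3) ≤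
      Real.pi * (2 * Real.sqrt 3 ^ 3 / 3 - Real.sqrt 3 ^ 2 * (σ - 1) + (σ - 1) ^ 3 / 3) := by
  have h3sq : Real.sqrt 3 ^ 2 = 3 := Real.sq_sqrt (by norm_num)
  have h5sq : Real.sqrt 5 ^ 2 = 5 := Real.sq_sqrt (by norm_num)
  have h3cube : Real.sqrt 3 ^ 3 = 3 * Real.sqrt 3 := by
    rw [pow_succ, h3sq]
  have h5cube : Real.sqrt 5 ^ 3 = 5 * Real.sqrt 5 := by
    rw [pow_succ, h5sq]
  have h3lo : (1.732 : ℝ) < Real.sqrt 3 := by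
    rw [Real.lt_sqrt (by norm_num)]; norm_num
  have h5hi : Real.sqrt 5 < (2.2361 : ℝ) := by
    rw [Real.sqrt_lt' (by norm_num)]; norm_num
  have h5lo : (2.236 : ℝ) < Real.sqrt 5 := by
    rw [Real.lt_sqrt (by norm_num)]; norm_num
  rw [h3sq, h5sq, h3cube, h5cube]
  refine mul_le_mul_of_nonneg_left ?_ Real.pi_pos.le
  -- `D(σ) = 2√3 + 8/3 − 10√5/3 + 3σ − σ² ≥ 0` on `[1, √5]`
  have hprod : 0 ≤ (σ - 1) * (Real.sqrt 5 - σ) := mul_nonneg (by linarith) (by linarith)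
  nlinarith [hprod, h3lo, h5hi, h5lo, h1, h5]

end Summit.Ventures.Crystal3D.Theorems

end
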